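import Summits.AtomisticToContinuum.HydrodynamicLimit.Theses.InformationPercolationEngine
import Summits.AtomisticToContinuum.HydrodynamicLimit.Theorems.JParityClosureLocalSecondLawContactBundle
import Summits.AtomisticToContinuum.HydrodynamicLimit.Theorems.JParityClosureLocalSecondLawContactHistoryNetOfOscillation
import Summits.AtomisticToContinuum.HydrodynamicLimit.Theorems.JParityClosureLocalSecondLawContactPinnedRepresentationOfRegular
import Literature.MathematicalPhysics.KineticTheory.HardSphereEulerLLN
import Summits.AtomisticToContinuum.HydrodynamicLimit.Theorems.InformationPercolationEngineLocalSecondLawOneBodyStatics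
import Summits.AtomisticToContinuum.HydrodynamicLimit.Theorems.InformationPercolationEngineLocalSecondLawInitialMatchingOfStatics

/-!
# Line `contact-asymmetry-information` — RESHAPED checked skeleton (v3) for the crux `LocalSecondLaw`
(stmt-AtomisticToContinuum-13081; route InformationPercolationEngine, shared with JParityClosure — the two decls are
`Iff.rfl`-equal)

## v3 (lead c16, prover-line-stmt-AtomisticToContinuum-13081-c16-0, 2026-08-17T13Z) — the provable residual is run
v2's only stub provable on the decl AS TYPED is B′ `stub_initialMatching` (time-0 matching of the kinetic entropy of every bounded
tilt), blocked on two statics inputs absent from the tree (c11's ML1/ML2 = a5's input (b)).  v3 reshapes B′ AT THE SKELETON LEVEL: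
* NEW stub `stub_oneBodyStatics` (ML): the UNIFORM-in-`g` mean-square law of large numbers for the canonical hard-sphere gas at small
  reduced density — `∀ ε ∃ N₀ ∀ N ≥ N₀ ∀ g` measurable with `|g| ≤ 1`: `Ξ⁻¹ ∫ ((N+1)⁻¹ Σᵢ g(xᵢ) − ∫ g ρ₀)² 𝟙[hard core] dμ^{⊗(N+1)} ≤ ε`
  (`ρ₀ = rhoLim P σ`).  One statement giving BOTH ML1 (uniform one-body variance decay) and ML2 (`‖n_N − ρ₀‖_{L¹} → 0`, the one-body
  density in total variation).  Provable now: the tree's size-form cluster expansion with the termwise UNIFORM limits of the landed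
  kernel-uniform statics (`LGFS.coefN_kernel_uniform`, `onePt/twoPt/variance_kernel_uniform`, stmt-9905's supports) — for the family
  `{|g| ≤ 1}` the kernel-averaging error even disappears (`coefN(g) − coefLim(g) = ∫ g β (C ε^{3j} J_ε − γ_j βʲ)`, uniformly small by
  `MesoLLN.abs_Jint_sub_le`).
* NEW stub `stub_initialMatchingOfStatics` (ML → B′): the assembly held by the lead — conditioning lemma (Cauchy–Schwarz, landed
  `conditioningLemma_variance`) turns ML into `sup_S ‖n_S − ρ₀‖_{L¹} → 0` over tilts of mass `≥ δ″`; the velocity-tilt budget (landed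
  `contactB_velocityTiltBudget_bdd`) bounds `∫ n_S KL(f̂_S ‖ M)`; the decomposition `∫ f log f = n KL + n log n + ∫ f log M` then gives
  the HARD (upper) direction of B′, the Gibbs inequality the lower one; EOS continuity in the band and the `r → 0` moduli finish.
* M and K4 MERGED into `stub_kineticClosure` (identical `EnsFrame` shape `∀ f, |gap| ≤ η`; identical status: blocked on open cruxes
  13477+13080 resp. 9235 + unfiled inputs) to stay at seven stubs; v2's `stub_maxwellisation`, `stub_entropyFluxClosure`,
  `stub_initialMatching` are DERIVED below (`ensFrame_mono`), and `LocalSecondLaw_of` (v2, byte-identical) composes as before.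
Stubs of v3 (seven): T′ `stub_oscillationModulus`, R `stub_regularRange`, S `stub_exchangePairing`, K1∫ `stub_relativeOddChaosInt`,
MK4 `stub_kineticClosure`, ML `stub_oneBodyStatics`, B′|ML `stub_initialMatchingOfStatics`;
`LocalSecondLaw_of_v3 : T′ → R → S → K1∫ → MK4 → ML → (ML → B′) → InformationPercolationEngine.LocalSecondLaw`.
LINE STATUS UNCHANGED: dead on the decl as typed at R (class i) and K1∫/MK4/S (class ii) — standing records `Lines/*-dead.md`;
v3 only runs what is provable and reusable.  Restate as C′ (`Restatement.LocalSecondLawInBand`).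

## v2 (lead a5)
Lead seat prover-line-stmt-AtomisticToContinuum-13081-a5-0, 2026-08-17, after wave 1 (six workers) and the parallel lead c11's
wave (six workers; c11 ended `line-dead` 09:38Z).  v1 = the crux-plan seat's skeleton (tree `Lines/contact_asymmetry_information.lean`
at sha 1754f30f; stubs T, Q, S, K1, M, K4, B′).  ALL VOCABULARY NOW LIVES UNDER `Theorems/` (namespace
`…Theorems.LocalSecondLawContact`, files `JParityClosureLocalSecondLawContact{Defs,Kernel,Bundle}.lean`, p148403/p148405/p152721,
texts byte-identical to v1), so this file only states stubs and the composition.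

## What wave 1 changed (kernel-checked, landed `--supports stmt-13081`)
* T `stub_historyNet` = (density net, LANDED: `contactT_densityHistoryNet`, p149390) + (m_r/e_r sup-in-time net ⟸ an
  OSCILLATION MODULUS in probability of the coarse momentum/energy histories, LANDED reduction
  `contact_historyNet_of_oscillationModulus`, p151203).  The modulus is the new stub `stub_oscillationModulus` (T′) below — collision
  ACTIVITY control over short windows along the local-Gibbs dynamics; NO pathwise bound exists (a row of n nearly touching spheres
  transmits momentum arbitrarily fast), the entropy inequality against the invariant Gibbs law does not reach collision fluxes, and the
  nearest board items (CollisionTightness stmt-13085, CollisionActivityTails stmt-13734, stmt-17703) are OPEN and weaker.  No producer.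
* Q `stub_pinnedRepresentation` is PROVED on REGULAR-PLUS pinned cells in the pointwise form the composition consumes
  (`contactQ_pinned_of_regular_ge`, p152224, with `contactQ_mean_pinned` p151091, `contactQ_uniform_package` p151298): floors `c₀` on
  `ρ_r, θ_r`, cap `ρ_rσ³ ≤ η₁` inside an EOS band, energy cap `e_r ≤ Ē`, on `[0,τ] × 𝕋³`, for EVERY member of the cell.  The registered
  `2·μ|_S(…) ≤ μ S` text additionally needs `NullMeasurableSet S` (`contactQ_restrict_eq_zero_of_regular`); the composition below is
  rewired to the pointwise form (cell non-empty from its mass floor).  The regular-plus range is NECESSARY for any such comparison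
  (hot spots: `m/ρ`, cold populated balls: `−ρ log θ`, packing edge: bare-limsup `f_ex` are not uniformly continuous in the pinned
  variables) and becomes the new producer stub `stub_regularRange` (R) below: regular range IN MEASURE at ALL `τ` — the recorded-dead
  class (i) of this crux (`Lines/*-dead.md`; pre-shock producer only: `regularRangePreShock_of_densityCap` + DensityCap stmt-13082).
* K1 `stub_relativeOddChaos`: with a SIGN-FREE existential slack the typed pointwise form is EQUIVALENT, on admissible pairs, to the
  integrated budget `(1−κ)·asymR ≤ 2·prodR + η` (`exists_pointwise_iff_budget` / `contactKernel_collapse`, p152765; optimal slack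
  `e⋆ = −κJ/2 − (qJ−q)ψ_odd`, `∫e⋆ = (1−κ)A − P`).  K1 is therefore RESTATED below in that integrated form (`stub_relativeOddChaosInt`),
  which is all `LocalSecondLaw_of` ever used; it remains THE BET (Boltzmann-hypothesis class at fixed `σ`; no producer at any `τ`).
* S: existence of the one-particle density of every bounded tilt LANDED (`contactS_oneParticleDensity`, p150344); the contact density
  `q` needs a measurability repair of `contactPt` (`dirOf` discontinuous off the unit sphere) + the proved Campbell formula (L); the
  inequality half is blocked on EvenStressEnskog stmt-13079 (OPEN) + an unformalised renormalised first-marginal entropy balance (XL).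
* M: the pointwise Gibbs half LANDED (`contactM_Hs_le_hkin`, `contactM_gibbs_velocity`, p149458); the stub is blocked on ContactChaos
  stmt-13477 + RateFloor stmt-13080 (OPEN) + two non-items (MesoQuiescence, asymmetry coercivity).
* K4: the integrand split LANDED (`contactK4_flux_split`, p149425); blocked on EnergyCurrentTails stmt-9235 (OPEN, pre-shock) AND a new
  HEIGHT-tail input (thin fast velocity spikes of height `e^{cN}` pass every moment statement yet carry entropy flux) — no producer.
* B′: `condLaw` toolkit, time-0 fields of every tilt, velocity-tilt budget, data identification LANDED (p149683, p151233, p151754,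
  p151779, p152122, p152431, p152470); the consumed direction needs two PROVABLE statics inputs (uniform one-body variance / density LLN
  for tilted dilute canonical hard-sphere laws: c11's ML1/ML2, a5's input (b)) — the only residual of the line that is provable now.

## Stubs of v2 (seven; `sorry` only here): T′ `stub_oscillationModulus`, R `stub_regularRange`, S `stub_exchangePairing`,
K1∫ `stub_relativeOddChaosInt`, M `stub_maxwellisation`, K4 `stub_entropyFluxClosure`, B′ `stub_initialMatching`.
`LocalSecondLaw_of : T′ → R → S → K1∫ → M → K4 → B′ → InformationPercolationEngine.LocalSecondLaw` is kernel-checked below.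
Verdict of both leads: R (all-τ regular range, dead class i) has no producer on the board and no repair inside the line exists
(it is necessary for Q); T′, K4's height tails and S's balance are unfiled; K1∫, M sit on open cruxes — the line cannot run on the
decl AS TYPED; under the restatement C′ (`Restatement.LocalSecondLawInBand`) R is DensityCap-fed but T′/S/K1∫/M/K4 are unchanged.
-/

noncomputable section

open scoped BigOperators Topology Classical MeasureTheory ENNReal InnerProductSpace
open Filter Set MeasureTheory Function
open Literature.MathematicalPhysics.KineticTheory
open Literature.Analysis.FluidPDE
open Summit.AtomisticToContinuum.HydrodynamicLimit.Theses
open Summit.AtomisticToContinuum.HydrodynamicLimit.Theorems.LocalSecondLawNegative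
open Summit.AtomisticToContinuum.HydrodynamicLimit.Theorems.LocalSecondLawLedger
open Summit.AtomisticToContinuum.HydrodynamicLimit.Theorems.LocalSecondLawContact

namespace Summit.AtomisticToContinuum.HydrodynamicLimit.Cruxes.LocalSecondLaw.ContactAsymmetryInformation

variable {N : ℕ}

/-! ## § Statements of the stubs (v2 texts T′ R S K1∫ M K4 B′; v3 adds MK4 and ML) -/

/-- **T′ · oscillation modulus** (the residual of T after the landed density net and reduction): along the local-Gibbs dynamics,
for every amplitude `κ > 0` and mass `δ″ > 0` there is a window `h > 0` such that, eventually in `N`, coarse momentum and energy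
histories oscillate by more than `κ` over some pair of times `≤ h` apart only with probability `≤ δ″`.  Text = the hypothesis of
the landed `contact_historyNet_of_oscillationModulus` (p151203).  Collision-activity class; no producer. -/
def Stubs.stub_oscillationModulus : Prop :=
  ∀ (a₀ θ₀ : T3 → ℝ) (u₀ : T3 → V3), Continuous a₀ → Continuous θ₀ → Continuous u₀ → (∀ x, 0 < a₀ x) → (∀ x, 0 < θ₀ x) →
    ∃ σ₀ : ℝ, 0 < σ₀ ∧ ∀ σ : ℝ, 0 < σ → σ < σ₀ → ∀ Φ : (N : ℕ) → Flow σ N, ∀ τ : ℝ, 0 < τ → ∀ κ δ'' : ℝ, 0 < κ → 0 < δ'' →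
      ∀ r : ℝ, 0 < r → ∃ h : ℝ, 0 < h ∧ ∃ N₁ : ℕ, ∀ N : ℕ, N₁ ≤ N →
        localGibbsLaw σ a₀ u₀ θ₀ N (Φ N) {z | ∃ s ∈ Set.Icc (0 : ℝ) τ, ∃ s' ∈ Set.Icc (0 : ℝ) τ, |s - s'| ≤ h ∧ ∃ x : T3,
          κ < ‖momC r ((Φ N).flow s z) x - momC r ((Φ N).flow s' z) x‖ ∨
            κ < |kinC r ((Φ N).flow s z) x - kinC r ((Φ N).flow s' z) x|} ≤ ENNReal.ofReal δ''

/-- **R · regular range in measure** (the residual of Q after the landed conditional theorem): for `σ < σ₀(profiles)`, the crux's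
Euler data and flows, and every horizon `τ`, there are an EOS band and floors/caps `(c₀, η₁, Ē)` such that for every `δ > 0`,
for `r < r₀(δ)` and `N ≥ N₀(r)`, all but `δ` of the local-Gibbs mass is REGULAR-PLUS on `[0,τ] × 𝕋³` (good orbit, `c₀ ≤ ρ_r`,
`ρ_rσ³ ≤ η₁`, `c₀ ≤ θ_r`, `e_r ≤ Ē`).  ALL `τ`: the recorded-dead class (i) of this crux; pre-shock producer only. -/
def Stubs.stub_regularRange : Prop :=
  ∀ (a₀ θ₀ : T3 → ℝ) (u₀ : T3 → V3), Continuous a₀ → Continuous θ₀ → Continuous u₀ → (∀ x, 0 < a₀ x) → (∀ x, 0 < θ₀ x) →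
    ∃ σ₀ : ℝ, 0 < σ₀ ∧ ∀ σ : ℝ, 0 < σ → σ < σ₀ →
      ∀ (T : ℝ) (ρ θ : ℝ → T3 → ℝ) (u : ℝ → T3 → V3), IsHardSphereEulerSolution σ T ρ u θ →
        ∀ Φ : (N : ℕ) → Flow σ N,
          TendstoHydroFieldsAt (fun N => localGibbsLaw σ a₀ u₀ θ₀ N (Φ N)) Φ ρ u θ 0 → 0 < T →
            ∀ τ : ℝ, 0 < τ → ∃ η₀ : ℝ, ∃ F : ℝ → ℝ, EosBand η₀ F ∧ ∃ c₀ η₁ Ē : ℝ, 0 < c₀ ∧ 0 < η₁ ∧ η₁ < η₀ ∧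
              ∀ δ : ℝ, 0 < δ → ∃ r₀ : ℝ, 0 < r₀ ∧ ∀ r : ℝ, 0 < r → r < r₀ → ∃ N₀ : ℕ, ∀ N : ℕ, N₀ ≤ N →
                localGibbsLaw σ a₀ u₀ θ₀ N (Φ N)
                    {z | ¬ (Regular σ r τ c₀ η₁ (Φ N) z ∧ ∀ s ∈ Set.Icc (0 : ℝ) τ, ∀ x : T3, kinC r ((Φ N).flow s z) x ≤ Ē)}
                  ≤ ENNReal.ofReal δ

/-- **S · exchange pairing** (text of v1, registered twin `contact_exchangePairing`). -/
def Stubs.stub_exchangePairing : Prop :=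
  EnsFrame fun σ r τ η φ _ _ N Φ μ S =>
    ∃ f q, IsOneParticleDensity τ (condLaw μ S) Φ f ∧ IsContactDensity τ (condLaw μ S) Φ q ∧
      Admissible σ r τ φ q f N ∧ -η ≤ kinWeakForm σ r τ φ f (condLaw μ S) Φ - prodR σ r τ φ q f N

/-- **K1∫ · relative odd chaos, integrated form** (THE BET, restated): at a contrast level `κ < 1` fixed right after `σ`, for every
ADMISSIBLE (one-particle density, contact density) pair of the conditioned law, `(1 − κ)·A ≤ 2·P_R + η` — i.e. `X ≥ −κA − η`.
Equivalent on admissible pairs to the typed v1 K1 (`contactKernel_collapse`); all that the composition uses. -/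
def Stubs.stub_relativeOddChaosInt : Prop :=
  EnsFrameK fun κ σ r τ η φ _ _ N Φ μ S =>
    ∀ f q, IsOneParticleDensity τ (condLaw μ S) Φ f → IsContactDensity τ (condLaw μ S) Φ q → Admissible σ r τ φ q f N →
      (1 - κ) * asymR r τ φ q ≤ 2 * prodR σ r τ φ q f N + η

/-- **M · Maxwellisation** (text of v1, registered twin `contact_maxwellisation`). -/
def Stubs.stub_maxwellisation : Prop :=
  EnsFrame fun σ r τ η φ _ _ _ Φ μ S =>
    ∀ f, IsOneParticleDensity τ (condLaw μ S) Φ f → |maxwellGapEns σ r τ φ f (condLaw μ S) Φ| ≤ η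

/-- **K4 · entropy-flux closure** (text of v1, registered twin `contact_entropyFluxClosure`). -/
def Stubs.stub_entropyFluxClosure : Prop :=
  EnsFrame fun σ r τ η φ _ _ _ Φ μ S =>
    ∀ f, IsOneParticleDensity τ (condLaw μ S) Φ f → |fluxGapEns σ r τ φ f (condLaw μ S) Φ| ≤ η

/-- **B′ · initial matching** (text of v1, registered twin `contact_initialMatching`). -/
def Stubs.stub_initialMatching : Prop :=
  EnsFrame fun σ r τ η φ ρ θ _ Φ μ S =>
    ∀ f, IsOneParticleDensity τ (condLaw μ S) Φ f → |initialGapEns σ r φ f (condLaw μ S) Φ (ρ 0) (θ 0)| ≤ η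

/-- **MK4 · kinetic closure** (v3: M and K4 merged — same frame, same shape, same status): for every one-particle density of the
conditioned law both the Maxwellisation gap and the entropy-flux gap are `≤ η` in absolute value. -/
def Stubs.stub_kineticClosure : Prop :=
  EnsFrame fun σ r τ η φ _ _ _ Φ μ S =>
    ∀ f, IsOneParticleDensity τ (condLaw μ S) Φ f →
      |maxwellGapEns σ r τ φ f (condLaw μ S) Φ| ≤ η ∧ |fluxGapEns σ r τ φ f (condLaw μ S) Φ| ≤ η

/-- **ML · one-body statics** (v3, NEW; c11's ML1 ∧ ML2 in one statement): the UNIFORM-in-`g` mean-square law of large numbers for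
the configurational canonical hard-sphere gas `Ξ⁻¹ · (β dy)^{⊗(N+1)}|_{hard core}` at small reduced density (`SmallDensity P σ`, the
tree's cluster-expansion regime): for every `ε > 0`, eventually in `N`, for EVERY measurable `g` with `|g| ≤ 1`,
`Ξ_N(N+1)⁻¹ ∫ ((N+1)⁻¹ Σᵢ g(xᵢ) − ∫ g ρ₀)² 𝟙[hard core] dμ^{⊗(N+1)} ≤ ε`, `ρ₀ = rhoLim P σ`.  (The tree's
`SmallDensity.tendsto_variance` is this for ONE continuous `χ`; uniformity over `{|g| ≤ 1}` = termwise uniform cluster limits, as in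
the landed `LGFS.*_kernel_uniform`.)  Consequences: `sup_{|g|≤1} Var → 0` (ML1) and `‖n_N − ρ₀‖_{L¹(𝕋³)} → 0` (ML2). -/
def Stubs.stub_oneBodyStatics : Prop :=
  ∀ (P : DensityProfile) (σ : ℝ), SmallDensity P σ → ∀ ε : ℝ, 0 < ε → ∃ N₀ : ℕ, ∀ N : ℕ, N₀ ≤ N →
    ∀ g : T3 → ℝ, Measurable g → (∀ y, |g y| ≤ 1) →
      (∫ x, ((((N + 1 : ℕ) : ℝ))⁻¹ * ∑ i, g (x i) - ∫ y, g y * rhoLim P σ y) ^ 2 *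
          Literature.MathematicalPhysics.StatisticalMechanics.efR (Ov (hsDiameter σ N)) x (Finset.univ : Finset (Fin (N + 1)))
          ∂Measure.pi (fun _ : Fin (N + 1) => P.μ)) / XiN P σ N (N + 1) ≤ ε

/-- Monotonicity of the ensemble frame in its conclusion (used to derive v2's M, K4 from v3's MK4). -/
theorem ensFrame_mono
    {c₁ c₂ : (σ r τ η : ℝ) → (φ : ℝ → T3 → ℝ) → (ρ θ : ℝ → T3 → ℝ) → (N : ℕ) → Flow σ N →
      Measure (Phase N) → Set (Phase N) → Prop}
    (h : ∀ σ r τ η φ ρ θ N Φ μ S, c₁ σ r τ η φ ρ θ N Φ μ S → c₂ σ r τ η φ ρ θ N Φ μ S) :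
    EnsFrame c₁ → EnsFrame c₂ := by
  intro hF a₀ θ₀ u₀ ha hθ hu ha0 hθ0
  obtain ⟨σ₀, hσ₀, H⟩ := hF a₀ θ₀ u₀ ha hθ hu ha0 hθ0
  refine ⟨σ₀, hσ₀, fun σ hσ hσ' T ρ θ u hE Φ hL hT τ hτ φ hφ hφ0 hsupp η hη => ?_⟩
  obtain ⟨η', hη', r₀, hr₀, H2⟩ := H σ hσ hσ' T ρ θ u hE Φ hL hT τ hτ φ hφ hφ0 hsupp η hη
  refine ⟨η', hη', r₀, hr₀, fun r hr hrr δ'' hδ'' => ?_⟩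
  obtain ⟨N₀, H3⟩ := H2 r hr hrr δ'' hδ''
  exact ⟨N₀, fun N hN S hS c hc => h _ _ _ _ _ _ _ _ _ _ _ (H3 N hN S hS c hc)⟩

/-- The registered v1 text of T (`Stubs.stub_historyNet`, twin `contact_historyNet`). -/
def Stubs.stub_historyNet : Prop :=
  ∀ (a₀ θ₀ : T3 → ℝ) (u₀ : T3 → V3), Continuous a₀ → Continuous θ₀ → Continuous u₀ →
    (∀ x, 0 < a₀ x) → (∀ x, 0 < θ₀ x) →
    ∃ σ₀ : ℝ, 0 < σ₀ ∧ ∀ σ : ℝ, 0 < σ → σ < σ₀ →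
      ∀ Φ : (N : ℕ) → Flow σ N, ∀ τ : ℝ, 0 < τ → ∀ η' δ' : ℝ, 0 < η' → 0 < δ' → ∀ r : ℝ, 0 < r →
        ∃ M : ℕ, 0 < M ∧ ∃ N₀ : ℕ, ∀ N : ℕ, N₀ ≤ N → ∃ c : Fin M → Centre,
          localGibbsLaw σ a₀ u₀ θ₀ N (Φ N) {z | ∀ j : Fin M, z ∉ Pin σ r τ η' (Φ N) (c j)} ≤ ENNReal.ofReal δ'

/-- **v1's T from v2's T′** — the landed reduction (`contact_historyNet_of_oscillationModulus`, p151203; density net p149390). -/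
theorem stub_historyNet_of (hOsc : Stubs.stub_oscillationModulus) : Stubs.stub_historyNet :=
  contact_historyNet_of_oscillationModulus hOsc

/-! ## § The stubs (registered obligations of v3: T′ R S K1∫ MK4 ML B′|ML; `sorry` only here) -/

/-- **T′ · `stub_oscillationModulus`** — collision-activity class, all `τ`, no producer (see the module docstring). -/
theorem stub_oscillationModulus : Stubs.stub_oscillationModulus := by
  sorry

/-- **R · `stub_regularRange`** — regular range in measure at all `τ` (recorded-dead class (i) of the crux; pre-shock producer
`regularRangePreShock_of_densityCap` + DensityCap stmt-13082 + an r-independent energy cap from the field LLN). -/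
theorem stub_regularRange : Stubs.stub_regularRange := by
  sorry

/-- **S · `stub_exchangePairing`** — f-existence landed (p150344); q-existence L; inequality blocked on EvenStressEnskog stmt-13079. -/
theorem stub_exchangePairing : Stubs.stub_exchangePairing := by
  sorry

/-- **K1∫ · `stub_relativeOddChaosInt`** — THE BET (integrated relative odd chaos `X ≥ −κA − η`); no producer. -/
theorem stub_relativeOddChaosInt : Stubs.stub_relativeOddChaosInt := by
  sorry

/-- **MK4 · `stub_kineticClosure`** (v3 = v2's M ∧ K4) — blocked on ContactChaos stmt-13477 + RateFloor stmt-13080 (+ MesoQuiescence,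
coercivity) for the Maxwellisation half and on EnergyCurrentTails stmt-9235 + an unfiled height-tail input for the flux half. -/
theorem stub_kineticClosure : Stubs.stub_kineticClosure := by
  sorry

/-- **ML · `stub_oneBodyStatics`** (v3) — PROVED: uniform-in-`g` mean-square LLN of the canonical hard-sphere gas at small reduced
density (`Theorems/InformationPercolationEngineLocalSecondLawOneBodyStatics{OnePt,}.lean`, p164412/p164771, lead c16's wave-1 worker). -/
theorem stub_oneBodyStatics : Stubs.stub_oneBodyStatics :=
  Summit.AtomisticToContinuum.HydrodynamicLimit.Theorems.LocalSecondLawOneBodyStatics.stub_oneBodyStatics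

/-- **B′|ML · `stub_initialMatchingOfStatics`** (v3; the lead's stub) — PROVED (lead c16: Theorems/InformationPercolationEngineLocalSecondLaw
InitialMatching{TV,EntropyModulus,VelocityKLTrunc,VelocityKL,EnergyFluct,Energy,Term1Decomp,Term1,Pointwise,OfStatics}.lean; p164088 … p168703 +
OfStatics): the initial matching of every bounded tilt GIVEN the one-body statics — conditioning lemma + velocity-tilt relative-entropy budget +
`∫ f log f = n·KL + n log n + ∫ f log M` + position-entropy modulus + peculiar-energy variance + EOS continuity + `r → 0`. -/
theorem stub_initialMatchingOfStatics : Stubs.stub_oneBodyStatics → Stubs.stub_initialMatching :=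
  Summit.AtomisticToContinuum.HydrodynamicLimit.Theorems.LocalSecondLawInitialMatching.initialMatching_of_oneBodyStatics

/-! ### v2's M, K4, B′ derived from the v3 stubs (no `sorry` here) -/

/-- v2's M from v3's MK4. -/
theorem stub_maxwellisation : Stubs.stub_maxwellisation :=
  ensFrame_mono (fun _ _ _ _ _ _ _ _ _ _ _ h f hf => (h f hf).1) stub_kineticClosure

/-- v2's K4 from v3's MK4. -/
theorem stub_entropyFluxClosure : Stubs.stub_entropyFluxClosure :=
  ensFrame_mono (fun _ _ _ _ _ _ _ _ _ _ _ h f hf => (h f hf).2) stub_kineticClosure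

/-- v2's B′ from v3's ML and B′|ML. -/
theorem stub_initialMatching : Stubs.stub_initialMatching :=
  stub_initialMatchingOfStatics stub_oneBodyStatics

/-! ## § Composition v2: the seven stubs imply the crux BY NAME (kernel-checked; no `sorry` from here on) -/

section Composition

/-- ENNReal pigeonhole: if a set of measure `> δ` is covered by an exceptional set of measure `≤ δ/2` and `M ≥ 1` cells,
one cell meets it in measure `≥ δ/(2M)`. -/
theorem exists_cell_of_measure_gt {α : Type*} [MeasurableSpace α] (μ : Measure α) {M : ℕ} (hM : 0 < M)
    (B U : Set α) (P : Fin M → Set α) {δ : ℝ} (hδ : 0 < δ)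
    (hcover : B ⊆ U ∪ ⋃ j, (B ∩ P j)) (hU : μ U ≤ ENNReal.ofReal (δ / 2))
    (hB : ¬ μ B ≤ ENNReal.ofReal δ) :
    ∃ j : Fin M, ENNReal.ofReal (δ / (2 * M)) ≤ μ (B ∩ P j) := by
  by_contra hcon
  push Not at hcon
  apply hB
  have hsum : ∑ j : Fin M, μ (B ∩ P j) ≤ ∑ _j : Fin M, ENNReal.ofReal (δ / (2 * M)) :=
    Finset.sum_le_sum fun j _ => (hcon j).le
  have hM' : (0 : ℝ) < M := by exact_mod_cast hM
  have hconst : ∑ _j : Fin M, ENNReal.ofReal (δ / (2 * M)) = ENNReal.ofReal (δ / 2) := by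
    rw [Finset.sum_const, Finset.card_univ, Fintype.card_fin, ← ENNReal.ofReal_nsmul]
    congr 1
    rw [nsmul_eq_mul]
    field_simp
  calc μ B ≤ μ (U ∪ ⋃ j, (B ∩ P j)) := measure_mono hcover
    _ ≤ μ U + μ (⋃ j, (B ∩ P j)) := measure_union_le _ _
    _ ≤ μ U + ∑ j : Fin M, μ (B ∩ P j) := add_le_add le_rfl (measure_iUnion_fintype_le μ _)
    _ ≤ ENNReal.ofReal (δ / 2) + ENNReal.ofReal (δ / 2) := add_le_add hU (hsum.trans hconst.le)
    _ = ENNReal.ofReal δ := by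
        rw [← ENNReal.ofReal_add (by positivity) (by positivity)]; congr 1; ring

/-- The covering used by the pigeonhole, with a regular event `R`: `B ⊆ ({∀ j, ∉ P j} ∪ Rᶜ) ∪ ⋃ⱼ (B ∩ (P j ∩ R))`. -/
theorem subset_exceptional_union {α : Type*} {M : ℕ} (B R : Set α) (P : Fin M → Set α) :
    B ⊆ ({z | ∀ j : Fin M, z ∉ P j} ∪ Rᶜ) ∪ ⋃ j, (B ∩ (P j ∩ R)) := by
  intro z hz
  by_cases hR : z ∈ R
  · by_cases h : ∃ j : Fin M, z ∈ P j
    · obtain ⟨j, hj⟩ := h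
      exact Or.inr (Set.mem_iUnion.2 ⟨j, hz, hj, hR⟩)
    · push Not at h
      exact Or.inl (Or.inl h)
  · exact Or.inl (Or.inr hR)

/-- The bad set of a hard-sphere flow is null for the local Gibbs law (`≪` Liouville). -/
theorem localGibbsLaw_compl_good (σ : ℝ) (a₀ θ₀ : T3 → ℝ) (u₀ : T3 → V3) (N : ℕ) (Φ : Flow σ N) :
    localGibbsLaw σ a₀ u₀ θ₀ N Φ Φ.goodᶜ = 0 := by
  unfold localGibbsLaw particleLaw
  exact withDensity_absolutelyContinuous _ _ Φ.measure_compl_good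

/-- `P_R ≥ −η/2` from the integrated budget at level `κ ≤ 1` and the Gibbs sign `A ≥ 0` (admissibility). -/
theorem prodR_ge_of_budget {σ r τ : ℝ} {φ : ℝ → T3 → ℝ} {q : Bundle → ℝ} {f : Pt1 → ℝ}
    (hAdm : Admissible σ r τ φ q f N) {κ η : ℝ} (hκ : κ ≤ 1)
    (hB : (1 - κ) * asymR r τ φ q ≤ 2 * prodR σ r τ φ q f N + η) :
    -(η / 2) ≤ prodR σ r τ φ q f N := by
  obtain ⟨i1, -, i3, -, hq⟩ := hAdm
  have hA : 0 ≤ asymR r τ φ q := asymmetryInfo_nonneg_of_ae (measurePreserving_Rhat τ) Rhat_involutive i1 i3 hq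
  have h1 : 0 ≤ (1 - κ) * asymR r τ φ q := mul_nonneg (by linarith) hA
  linarith

/-- **The crux from the seven stubs of v2** (kernel-checked; concludes `InformationPercolationEngine.LocalSecondLaw` BY NAME).
Order of choices: `σ₀ := min` of the seven thresholds and `1/2`; given the crux's data: R yields the EOS band and `(c₀, η₁, Ē)`;
the LANDED conditional Q at tolerance `η/6` yields `η_Q`; the five ensemble stubs at tolerance `η/6` yield their resolutions and
radii; `η′ := min`, `r₀ := min` (with R's `r₀(δ/4)` and `1/2`); given `r < r₀`: the derived net T at `(η′, δ/4, r)` yields `M`;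
`δ″ := δ/(2M)`; `N₀ := max`.  For `N ≥ N₀` suppose `P_N(Bad) > δ`: pigeonhole against the net AND the regular event gives a cell
`S = Bad ∩ (Pin_j ∩ Reg)` of mass `≥ δ″`; S/K1∫ give `P_R ≥ −η/12`, `𝒦 − P_R ≥ −η/6`, M/K4/B′ the three gaps `≥ −η/6`, so
`𝓘 + init_E ≥ −3η/4`; the landed Q on the regular-plus cell gives `I(z) ≥ 𝓘 − η/6` for EVERY `z ∈ S`, contradicting `S ⊆ Bad`
(`I + init_E < −η`) since `S ≠ ∅`. -/
theorem LocalSecondLaw_of (hOsc : Stubs.stub_oscillationModulus) (hR : Stubs.stub_regularRange)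
    (hS : Stubs.stub_exchangePairing) (hK1 : Stubs.stub_relativeOddChaosInt) (hM : Stubs.stub_maxwellisation)
    (hK4 : Stubs.stub_entropyFluxClosure) (hB : Stubs.stub_initialMatching) :
    InformationPercolationEngine.LocalSecondLaw := by
  have hT : Stubs.stub_historyNet := stub_historyNet_of hOsc
  intro a₀ θ₀ u₀ ha hθ hu ha0 hθ0
  obtain ⟨σT, hσT, HT⟩ := hT a₀ θ₀ u₀ ha hθ hu ha0 hθ0
  obtain ⟨σR, hσR, HR⟩ := hR a₀ θ₀ u₀ ha hθ hu ha0 hθ0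
  obtain ⟨σS, hσS, HS⟩ := hS a₀ θ₀ u₀ ha hθ hu ha0 hθ0
  obtain ⟨σK, hσK, HK⟩ := hK1 a₀ θ₀ u₀ ha hθ hu ha0 hθ0
  obtain ⟨σM, hσM, HM⟩ := hM a₀ θ₀ u₀ ha hθ hu ha0 hθ0
  obtain ⟨σF, hσF, HF⟩ := hK4 a₀ θ₀ u₀ ha hθ hu ha0 hθ0
  obtain ⟨σB, hσB, HB⟩ := hB a₀ θ₀ u₀ ha hθ hu ha0 hθ0
  refine ⟨min (min (min σT σR) (min σS σK)) (min (min σM σF) (min σB (1 / 2))), by positivity, ?_⟩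
  intro σ hσ hσlt T ρ θ u hE Φ hLLN hTpos τ hτ φ hφ hφ0 hsupp η δ hη hδ
  have hσT' : σ < σT := hσlt.trans_le (le_trans (min_le_left _ _) (le_trans (min_le_left _ _) (min_le_left _ _)))
  have hσR' : σ < σR := hσlt.trans_le (le_trans (min_le_left _ _) (le_trans (min_le_left _ _) (min_le_right _ _)))
  have hσS' : σ < σS := hσlt.trans_le (le_trans (min_le_left _ _) (le_trans (min_le_right _ _) (min_le_left _ _)))
  have hσK' : σ < σK := hσlt.trans_le (le_trans (min_le_left _ _) (le_trans (min_le_right _ _) (min_le_right _ _)))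
  have hσM' : σ < σM := hσlt.trans_le (le_trans (min_le_right _ _) (le_trans (min_le_left _ _) (min_le_left _ _)))
  have hσF' : σ < σF := hσlt.trans_le (le_trans (min_le_right _ _) (le_trans (min_le_left _ _) (min_le_right _ _)))
  have hσB' : σ < σB := hσlt.trans_le (le_trans (min_le_right _ _) (le_trans (min_le_right _ _) (min_le_left _ _)))
  have hσhalf : σ ≤ 1 / 2 :=
    (hσlt.trans_le (le_trans (min_le_right _ _) (le_trans (min_le_right _ _) (min_le_right _ _)))).le
  have hη6 : 0 < η / 6 := by positivity
  -- R: the EOS band and the regular-plus constants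
  obtain ⟨η₀, F, hEos, c₀, η₁, Ē, hc₀, hη₁, hη₁₀, HR1⟩ := HR σ hσ hσR' T ρ θ u hE Φ hLLN hTpos τ hτ
  -- the landed conditional Q at tolerance η/6
  obtain ⟨ηQ, hηQ, HQ'⟩ := contactQ_pinned_of_regular_ge hEos σ c₀ η₁ Ē τ hσ hc₀ hη₁ hη₁₀ hτ φ hφ (η / 6) hη6
  -- the five ensemble stubs at tolerance η/6
  obtain ⟨ηS, hηS, rS, hrS, HS'⟩ := HS σ hσ hσS' T ρ θ u hE Φ hLLN hTpos τ hτ φ hφ hφ0 hsupp (η / 6) hη6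
  obtain ⟨κ, hκ1, HKκ⟩ := HK σ hσ hσK'
  have hκ : κ ≤ 1 := hκ1.le
  obtain ⟨ηK, hηK, rK, hrK, HK'⟩ := HKκ T ρ θ u hE Φ hLLN hTpos τ hτ φ hφ hφ0 hsupp (η / 6) hη6
  obtain ⟨ηM, hηM, rM, hrM, HM'⟩ := HM σ hσ hσM' T ρ θ u hE Φ hLLN hTpos τ hτ φ hφ hφ0 hsupp (η / 6) hη6
  obtain ⟨ηF, hηF, rF, hrF, HF'⟩ := HF σ hσ hσF' T ρ θ u hE Φ hLLN hTpos τ hτ φ hφ hφ0 hsupp (η / 6) hη6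
  obtain ⟨ηB, hηB, rB, hrB, HB'⟩ := HB σ hσ hσB' T ρ θ u hE Φ hLLN hTpos τ hτ φ hφ hφ0 hsupp (η / 6) hη6
  -- the common pinning resolution
  set η' : ℝ := min (min ηQ (min ηS ηK)) (min ηM (min ηF ηB)) with hη'def
  have hη'pos : 0 < η' := by positivity
  have hη'Q : η' ≤ ηQ := le_trans (min_le_left _ _) (min_le_left _ _)
  have hη'S : η' ≤ ηS := le_trans (min_le_left _ _) (le_trans (min_le_right _ _) (min_le_left _ _))
  have hη'K : η' ≤ ηK := le_trans (min_le_left _ _) (le_trans (min_le_right _ _) (min_le_right _ _))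
  have hη'M : η' ≤ ηM := le_trans (min_le_right _ _) (min_le_left _ _)
  have hη'F : η' ≤ ηF := le_trans (min_le_right _ _) (le_trans (min_le_right _ _) (min_le_left _ _))
  have hη'B : η' ≤ ηB := le_trans (min_le_right _ _) (le_trans (min_le_right _ _) (min_le_right _ _))
  -- R at mass δ/4: its radius
  have hδ4 : 0 < δ / 4 := by positivity
  obtain ⟨rR, hrR, HR2⟩ := HR1 (δ / 4) hδ4
  -- the common radius (with R's radius at mass δ/4 and 1/2 for the landed Q)
  refine ⟨min (min (min (1 / 2) rR) (min rS rK)) (min rM (min rF rB)), by positivity, ?_⟩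
  intro r hr hrlt
  have hrhalf : r < 1 / 2 := hrlt.trans_le (le_trans (min_le_left _ _) (le_trans (min_le_left _ _) (min_le_left _ _)))
  have hrR' : r < rR := hrlt.trans_le (le_trans (min_le_left _ _) (le_trans (min_le_left _ _) (min_le_right _ _)))
  have hrS' : r < rS := hrlt.trans_le (le_trans (min_le_left _ _) (le_trans (min_le_right _ _) (min_le_left _ _)))
  have hrK' : r < rK := hrlt.trans_le (le_trans (min_le_left _ _) (le_trans (min_le_right _ _) (min_le_right _ _)))
  have hrM' : r < rM := hrlt.trans_le (le_trans (min_le_right _ _) (min_le_left _ _))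
  have hrF' : r < rF := hrlt.trans_le (le_trans (min_le_right _ _) (le_trans (min_le_right _ _) (min_le_left _ _)))
  have hrB' : r < rB := hrlt.trans_le (le_trans (min_le_right _ _) (le_trans (min_le_right _ _) (min_le_right _ _)))
  -- the net at (η', δ/4, r) and R's threshold at r
  obtain ⟨M, hMpos, NT, HT'⟩ := HT σ hσ hσT' Φ τ hτ η' (δ / 4) hη'pos hδ4 r hr
  obtain ⟨NR, HR3⟩ := HR2 r hr hrR'
  -- the mass floor of a pigeonholed cell
  set δ'' : ℝ := δ / (2 * M) with hδ''def
  have hMreal : (0 : ℝ) < M := by exact_mod_cast hMpos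
  have hδ'' : 0 < δ'' := by positivity
  obtain ⟨NS, HS''⟩ := HS' r hr hrS' δ'' hδ''
  obtain ⟨NK, HK''⟩ := HK' r hr hrK' δ'' hδ''
  obtain ⟨NM, HM''⟩ := HM' r hr hrM' δ'' hδ''
  obtain ⟨NF, HF''⟩ := HF' r hr hrF' δ'' hδ''
  obtain ⟨NB, HB''⟩ := HB' r hr hrB' δ'' hδ''
  refine ⟨max (max (max NT NR) (max NS NK)) (max (max NM NF) NB), fun N hN => ?_⟩
  have hNT : NT ≤ N := le_trans (le_trans (le_trans (le_max_left _ _) (le_max_left _ _)) (le_max_left _ _)) hN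
  have hNR : NR ≤ N := le_trans (le_trans (le_trans (le_max_right _ _) (le_max_left _ _)) (le_max_left _ _)) hN
  have hNS : NS ≤ N := le_trans (le_trans (le_trans (le_max_left _ _) (le_max_right _ _)) (le_max_left _ _)) hN
  have hNK : NK ≤ N := le_trans (le_trans (le_trans (le_max_right _ _) (le_max_right _ _)) (le_max_left _ _)) hN
  have hNM : NM ≤ N := le_trans (le_trans (le_trans (le_max_left _ _) (le_max_left _ _)) (le_max_right _ _)) hN
  have hNF : NF ≤ N := le_trans (le_trans (le_trans (le_max_right _ _) (le_max_left _ _)) (le_max_right _ _)) hN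
  have hNB : NB ≤ N := le_trans (le_trans (le_max_right _ _) (le_max_right _ _)) hN
  -- abbreviations
  set μ : Measure (Phase N) := localGibbsLaw σ a₀ u₀ θ₀ N (Φ N) with hμdef
  haveI : IsProbabilityMeasure μ := isProbabilityMeasure_localGibbsLaw ha hθ hu ha0 hθ0 hσhalf N (Φ N)
  set initE : ℝ := ∫ x : T3, Hs σ (ρ 0 x) (θ 0 x) * φ 0 x with hinitE
  set Bad : Set (Phase N) := {z | entropyFunctional σ r τ φ (Φ N) z + initE < -η} with hBad
  set Reg : Set (Phase N) :=
    {z | Regular σ r τ c₀ η₁ (Φ N) z ∧ ∀ s ∈ Set.Icc (0 : ℝ) τ, ∀ x : T3, kinC r ((Φ N).flow s z) x ≤ Ē} with hRegdef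
  -- rewrite the crux event through the landed functional (definitional)
  change μ Bad ≤ ENNReal.ofReal δ
  by_contra hcon
  -- the net, the regular event, and the pigeonhole
  obtain ⟨c, hc⟩ := HT' N hNT
  have hRegc : μ Regᶜ ≤ ENNReal.ofReal (δ / 4) := HR3 N hNR
  have hU : μ ({z | ∀ j : Fin M, z ∉ Pin σ r τ η' (Φ N) (c j)} ∪ Regᶜ) ≤ ENNReal.ofReal (δ / 2) := by
    calc μ ({z | ∀ j : Fin M, z ∉ Pin σ r τ η' (Φ N) (c j)} ∪ Regᶜ)
        ≤ μ {z | ∀ j : Fin M, z ∉ Pin σ r τ η' (Φ N) (c j)} + μ Regᶜ := measure_union_le _ _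
      _ ≤ ENNReal.ofReal (δ / 4) + ENNReal.ofReal (δ / 4) := add_le_add hc hRegc
      _ = ENNReal.ofReal (δ / 2) := by
          rw [← ENNReal.ofReal_add (by positivity) (by positivity)]; congr 1; ring
  obtain ⟨j, hj⟩ := exists_cell_of_measure_gt μ hMpos Bad _ (fun j => Pin σ r τ η' (Φ N) (c j) ∩ Reg) hδ
    (subset_exceptional_union Bad Reg _) hU hcon
  set S : Set (Phase N) := Bad ∩ (Pin σ r τ η' (Φ N) (c j) ∩ Reg) with hSdef
  have hSmass : ENNReal.ofReal δ'' ≤ μ S := by rw [hδ''def]; exact hj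
  have hS0 : μ S ≠ 0 := by
    intro h0
    rw [h0] at hSmass
    have : ENNReal.ofReal δ'' = 0 := nonpos_iff_eq_zero.1 hSmass
    rw [ENNReal.ofReal_eq_zero] at this
    linarith
  have hSpin : ∀ {η₂ : ℝ}, η' ≤ η₂ → S ⊆ Pin σ r τ η₂ (Φ N) (c j) :=
    fun h => (Set.inter_subset_right.trans Set.inter_subset_left).trans (Pin_mono h (Φ N) (c j))
  have hSreg : ∀ z ∈ S, Regular σ r τ c₀ η₁ (Φ N) z ∧
      ∀ s ∈ Set.Icc (0 : ℝ) τ, ∀ x : T3, kinC r ((Φ N).flow s z) x ≤ Ē :=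
    fun z hz => hz.2.2
  -- the five ensemble stubs on the cell S
  have ES := HS'' N hNS S hSmass (c j) (hSpin hη'S)
  have EK := HK'' N hNK S hSmass (c j) (hSpin hη'K)
  have EM := HM'' N hNM S hSmass (c j) (hSpin hη'M)
  have EF := HF'' N hNF S hSmass (c j) (hSpin hη'F)
  have EB := HB'' N hNB S hSmass (c j) (hSpin hη'B)
  -- unpack S (densities, admissibility, exchange pairing) and K1∫ on them
  obtain ⟨f, q, hf, hq, hAdm, hXi⟩ := ES
  have hBudget := EK f q hf hq hAdm
  have hP : -((η / 6) / 2) ≤ prodR σ r τ φ q f N := prodR_ge_of_budget hAdm hκ hBudget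
  have hMg := EM f hf
  have hFg := EF f hf
  have hBg := EB f hf
  -- the ensemble ledger and the lower bound on the ensemble functional
  have hLedger := ensFunctional_add_init_eq σ r τ φ f (condLaw μ S) (Φ N) (ρ 0) (θ 0)
  have hEns : -(3 * η / 4) ≤ ensFunctional σ r τ φ (condLaw μ S) (Φ N) + initE := by
    rw [hinitE, hLedger]
    have h1 := (abs_le.1 hMg).1
    have h2 := (abs_le.1 hFg).1
    have h3 := (abs_le.1 hBg).1
    linarith
  -- the landed Q on the regular-plus pinned cell: EVERY member is within η/6 below the ensemble functional
  have hQ := HQ' (N := N) r hr hrhalf (Φ N) μ inferInstance (localGibbsLaw_compl_good σ a₀ θ₀ u₀ N (Φ N)) S hS0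
    (c j) (hSpin hη'Q) hSreg
  -- S is non-empty; any member contradicts S ⊆ Bad
  obtain ⟨z, hz⟩ := nonempty_of_measure_ne_zero hS0
  have hzB : z ∈ Bad := hz.1
  simp only [hBad, Set.mem_setOf_eq] at hzB
  have hQz := hQ z hz
  linarith

/-- **Closed form for the skeleton register**: the crux (JParityClosure copy — the shared item's primary decl; the
InformationPercolationEngine copy is the same proposition by `Iff.rfl`) from the seven registered stubs of v2.  NOT a proof of
the item: its axiom closure contains `sorryAx` through exactly the seven `stub_*` of v2. -/
theorem LocalSecondLaw_proof : JParityClosure.LocalSecondLaw :=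
  LocalSecondLaw_of stub_oscillationModulus stub_regularRange stub_exchangePairing stub_relativeOddChaosInt
    stub_maxwellisation stub_entropyFluxClosure stub_initialMatching

/-- The same closed form with the InformationPercolationEngine copy as its literal type. -/
theorem LocalSecondLaw_proof_ipe : InformationPercolationEngine.LocalSecondLaw :=
  LocalSecondLaw_of stub_oscillationModulus stub_regularRange stub_exchangePairing stub_relativeOddChaosInt
    stub_maxwellisation stub_entropyFluxClosure stub_initialMatching

/-- **The crux from the seven stubs of v3** (T′, R, S, K1∫, MK4, ML, B′|ML), through `LocalSecondLaw_of` of v2. -/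
theorem LocalSecondLaw_of_v3 (hOsc : Stubs.stub_oscillationModulus) (hR : Stubs.stub_regularRange)
    (hS : Stubs.stub_exchangePairing) (hK1 : Stubs.stub_relativeOddChaosInt) (hMK : Stubs.stub_kineticClosure)
    (hML : Stubs.stub_oneBodyStatics) (hBML : Stubs.stub_oneBodyStatics → Stubs.stub_initialMatching) :
    InformationPercolationEngine.LocalSecondLaw :=
  LocalSecondLaw_of hOsc hR hS hK1
    (ensFrame_mono (fun _ _ _ _ _ _ _ _ _ _ _ h f hf => (h f hf).1) hMK)
    (ensFrame_mono (fun _ _ _ _ _ _ _ _ _ _ _ h f hf => (h f hf).2) hMK)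
    (hBML hML)

/-- Closed form of v3 with the JParityClosure copy (the shared item's primary decl) as its literal type; axiom closure contains
`sorryAx` through exactly the seven `stub_*` of v3. -/
theorem LocalSecondLaw_proof_v3 : JParityClosure.LocalSecondLaw :=
  LocalSecondLaw_of_v3 stub_oscillationModulus stub_regularRange stub_exchangePairing stub_relativeOddChaosInt
    stub_kineticClosure stub_oneBodyStatics stub_initialMatchingOfStatics

end Composition

end Summit.AtomisticToContinuum.HydrodynamicLimit.Cruxes.LocalSecondLaw.ContactAsymmetryInformation

end
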